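import Summits.BirchSwinnertonDyer.BirchSwinnertonDyer.Theorems.ByReductionTypeAtTwoMultLowerHalfPrint
import Summits.BirchSwinnertonDyer.BirchSwinnertonDyer.Theorems.ByReductionTypeAtTwoMultKatoDescentRankZero
import HarnessLib

/-!
# Route `ByReductionTypeAtTwo`, item `MultLowerHalfAtTwo` (stmt-BirchSwinnertonDyer-19923), the K4ᵐ LOWER half's integral
# road: the PRINT binder `h15 = Greenberg1999.thm15_isTorsion_multiplicative_rat` (Thm. 1.5, Kato–Rohrlich) STRUCK — at
# analytic rank `0` «`X(E/ℚ_∞)` is `Λ`-torsion» at a multiplicative `2` is KERNEL modulo GZK (Prop. 3.7 + Thm. 1.4)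

HONEST FRAMING (cell `bsd-2adic`, run/shared/lean/pub/bsd-2adic/, seat `bsd-2adic-tower-1` GEN 28, HUMAN RULINGS
D-0036 / D-0054 / D-0074 / D-0152): theorems only (no definition, no named fact, no `sorry`); composition certificates; the
item stays OPEN with T-mult-4-int; nothing booked; no display re-keyed; BSD is not proved by any of this.
`ByReductionTypeAtTwoMultLowerHalfPrint.lean` (mult-3) feeds the torsion binder of `O1.missingLowerBoundAt_two_of_multEisenstein`
from `h15`; on its habitat «`r_an = 0`, Mult@2» the doors already carry GZK (`hGZK`), so `Sel_{p^∞}(E/ℚ)` is finite and the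
torsion of `X` is this seat's GEN 28 kernel theorem `MultKatoRat.isTorsion_of_mult_of_analyticRank_eq_zero` (Greenberg's
Prop. 3.7 at a multiplicative prime + Thm. 1.4, p. 96 — the printed warrant located by audit-1's D-AUDIT-h15 sheet):

* `missingLowerBoundAt_two_of_multEisenstein_of_greenberg'_of_control` — the per-pair LOWER half with `h15` STRUCK:
  PRINT {`h41ns`, `h41sp`, `hmod`, `hGZK`} + MEMO {`hGS` at a split `2`} + T-mult-4-int;
* `multLowerHalfAtTwo_of_multEisenstein_of_control` — the bridge to the route's child `MultLowerHalfAtTwo` (item 19923)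
  with `h15` STRUCK (`multLowerHalfAtTwo_of_multEisenstein_of_cotorsion` minus one PRINT binder).

References: R. Greenberg, LNM 1716 (1999), Thm. 1.4/1.5 (pp. 60–61), §3 Prop. 3.7 (p. 94), §4 pp. 96, 112–113;
R. L. Miller, LMS J. Comput. Math. 14 (2011), Def. 1.1.
-/

set_option autoImplicit false
-- the Theorems namespace of this sub repeats the summit name by design (D-0017 nested layout: Summit.<S>.<Sub>)
set_option linter.dupNamespace false

noncomputable section

open scoped Classical MatrixGroups ModularForm

open CongruenceSubgroup WeierstrassCurve Literature.NumberTheory.EllipticCurves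
  Literature.NumberTheory.EllipticCurves.ModularForms
  Literature.NumberTheory.EllipticCurves.Greenberg1999
  Literature.NumberTheory.EllipticCurves.Rank1Residual
  Literature.NumberTheory.EllipticCurves.Rank1Residual.Typed
  Summit.BirchSwinnertonDyer.Rank1Residual.X5

namespace Summit.BirchSwinnertonDyer.BirchSwinnertonDyer.Theorems

/-- **The per-pair LOWER half on «r_an = 0, Mult@2» from PRINT + GS-at-split-`2` + T-mult-4-int, K11-FREE and
`h15`-FREE (PROVED).** As `missingLowerBoundAt_two_of_multEisenstein_of_greenberg'_of_thm15` with the torsion binder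
supplied by the KERNEL (`MultKatoRat.isTorsion_of_mult_of_analyticRank_eq_zero`: GZK finiteness at analytic rank `0` +
Greenberg's control theorem at a multiplicative prime + Thm. 1.4) instead of Greenberg's Thm. 1.5: the guarded non-split
display (`h41ns`), the split display A236 (`h41sp`), modularity, GZK, Greenberg–Stevens at a split `2` (`hGS`) and
`O1.MultEisensteinDivisibilityAtTwo W` (T-mult-4-int) give `MissingLowerBoundAt W 2` for `E/ℚ` multiplicative at `2` of
analytic rank `0`. [cite: GreenbergLNM1716, Thm 1.4 (p. 60), §3 Prop. 3.7 (p. 94), §4 pp. 96 and 112–113]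
[cite: Miller2011LMS, Def. 1.1 and §1] -/
theorem missingLowerBoundAt_two_of_multEisenstein_of_greenberg'_of_control
    (W : WeierstrassCurve ℚ) [W.IsElliptic] [W.IsGloballyMinimal]
    (h41ns : thm41Analogue_charValue_rankZero_numberField_anyPrime_oddLocalDegree)
    (h41sp : thm41Analogue_charValue_rankZero_split_baseChange_anyPrime)
    (hmod : nonempty_modularParametrizationData)
    (hGZK : rank_eq_analyticRank_of_analyticRank_le_one)
    (hGS : W.HasSplitMultiplicativeReductionAtPrime 2 → greenberg_stevens (W := W) (p := 2))
    (hr : W.analyticRank = 0) (hmult : Mult W 2) (h : O1.MultEisensteinDivisibilityAtTwo W) :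
    MissingLowerBoundAt W 2 :=
  O1.missingLowerBoundAt_two_of_multEisenstein W
    (O1.twoAdicEulerCharRankZeroNonsplitMult_zero_of_greenberg' W h41ns)
    (O1.twoAdicEulerCharRankZeroSplitMult_zero_of_greenberg W h41sp) hmod hGZK
    (fun κ γ hκ hγ _ D => MultKatoRat.isTorsion_of_mult_of_analyticRank_eq_zero W hGZK hmult hr κ γ hκ hγ D)
    hGS hr hmult h

/-- **Bridge (T-mult-4-int ⇒ the lower half, item 19923), K11-FREE and `h15`-FREE.** PRINT {the guarded Thm-4.1 analogue
at a non-split multiplicative prime (`h41ns`), A236 (`h41sp`), modularity (`hmod`), GZK (`hGZK`)} + MEMO {Greenberg–Stevens at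
a split `2` (`hGS`)} + the ONE research object T-mult-4-int ∀-closed over non-CM `E/ℚ` of analytic rank `0` multiplicative at
`2` (`hE`) imply the route's child `MultLowerHalfAtTwo` — `multLowerHalfAtTwo_of_multEisenstein_of_cotorsion` with the PRINT
binder `h15` (Greenberg Thm. 1.5, Kato–Rohrlich) struck. Composition certificate; nothing asserted; the item stays OPEN with
T-mult-4-int. [cite: GreenbergLNM1716, Thm 1.4 (p. 60), §3 Prop. 3.7 (p. 94), §4 pp. 96 and 112–113] [cite: Miller2011LMS, Def 1.1] -/
theorem multLowerHalfAtTwo_of_multEisenstein_of_control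
    (h41ns : thm41Analogue_charValue_rankZero_numberField_anyPrime_oddLocalDegree)
    (h41sp : thm41Analogue_charValue_rankZero_split_baseChange_anyPrime)
    (hmod : nonempty_modularParametrizationData)
    (hGZK : rank_eq_analyticRank_of_analyticRank_le_one)
    (hGS : ∀ (W : WeierstrassCurve ℚ) [W.IsElliptic] [W.IsGloballyMinimal],
      W.HasSplitMultiplicativeReductionAtPrime 2 → greenberg_stevens (W := W) (p := 2))
    (hE : ∀ (W : WeierstrassCurve ℚ) [W.IsElliptic] [W.IsGloballyMinimal],
      ¬ W.HasCM → W.analyticRank = 0 → Mult W 2 → O1.MultEisensteinDivisibilityAtTwo W) :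
    Summit.BirchSwinnertonDyer.BirchSwinnertonDyer.Theses.ByReductionTypeAtTwo.MultLowerHalfAtTwo := by
  unfold Summit.BirchSwinnertonDyer.BirchSwinnertonDyer.Theses.ByReductionTypeAtTwo.MultLowerHalfAtTwo
  intro W _ _ hcm hr hmult
  exact missingLowerBoundAt_two_of_multEisenstein_of_greenberg'_of_control W h41ns h41sp hmod hGZK
    (hGS W) hr hmult (hE W hcm hr hmult)

end Summit.BirchSwinnertonDyer.BirchSwinnertonDyer.Theorems

end
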